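import Summits.Langlands.Langlands.Theses.FernRankSplit

/-!
# Route FernRankSplit — Assembly

The assembly item (stmt-Langlands-27018) of the child route `FernRankSplit` (decomp-langlands lens-3 gen 30 node, writer-1 g10
thaw slot 9; `--refines route-Langlands-DepthPrimeSplit:FernSpread`, the cell's route born 2026-09-01T00:04Z) for
FERN = `DepthPrimeSplit.FernSpread` (stmt-Langlands-25024):
`HeckeFern → FernRankBound → SizeDepthExchange → Summit.Langlands.Langlands.Theses.DepthPrimeSplit.FernSpread`.

This is literally the type of the route file's sorry-free deciding theorem `Summit.Langlands.Langlands.Theses.FernRankSplit.closes`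
(HF, RANK, EXCH ⟹ FERN). Nothing here proves `Langlands` (nor the parent piece FERN): the assembly records only that the items of the
route, taken together, imply the parent piece by name.
-/

set_option linter.dupNamespace false -- project-wide option (lakefile weak.linter.dupNamespace); `Summit.Langlands.Langlands` is the mandated namespace

namespace Summit.Langlands.Langlands.Theorems

/-- **Assembly of route FernRankSplit** (stmt-Langlands-27018):
`HeckeFern → FernRankBound → SizeDepthExchange → Summit.Langlands.Langlands.Theses.DepthPrimeSplit.FernSpread`.
Proof: unfold `Assembly` and apply the route's deciding theorem `Theses.FernRankSplit.closes`. -/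
theorem fernRankSplit_assembly_proof :
    Summit.Langlands.Langlands.Theses.FernRankSplit.Assembly := by
  unfold Summit.Langlands.Langlands.Theses.FernRankSplit.Assembly
  exact Summit.Langlands.Langlands.Theses.FernRankSplit.closes

end Summit.Langlands.Langlands.Theorems
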